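import Literature.MathematicalPhysics.QuantumManyBody.PeriodicBoseGas
import Mathlib.MeasureTheory.Measure.Lebesgue.EqHaar
import HarnessLib

/-!
# The second-order (Lee–Huang–Yang) upper bound on the ground-state energy of the dilute Bose gas (Basti–Cenatiempo–Schlein 2021, Thm. 1.1) and its fixed-density Dirichlet corollary

Topic `Literature/MathematicalPhysics/QuantumManyBody` (item `wi-16334`; wanted by
`stmt-AtomisticToContinuum-6594` = `LhyOrderUpperBound` of route
`AtomisticToContinuum/BECUvDepletionFloor`), companion of `PeriodicBoseGas.lean`
(`LSSY2005_upperBound_periodic`, the first-order Dyson–LSSY upper bound). Source read: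
G. Basti, S. Cenatiempo, B. Schlein, *A new second-order upper bound for the ground state energy of
dilute Bose gases*, Forum Math. Sigma 9 (2021) e74 (arXiv:2101.06222), §1, verbatim (p. 2–3):

* "We consider `N` bosons in a finite box `Λ_L = [-L/2, L/2]³ ⊂ ℝ³`, interacting via a two-body non
  negative, radial, compactly supported potential `V` with scattering length `𝔞`. The Hamilton
  operator has the form `H_L = -∑ᵢ Δᵢ + ∑_{i<j} V(xᵢ - xⱼ)` and acts on … `L²_s(Λ_L^N)` … (we use here
  units with particle mass `m = 1/2` and `ħ = 1`). We assume Dirichlet boundary conditions and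
  denote by `E(N,L)` the corresponding ground state energy. We are interested in the energy per
  unit volume in the thermodynamic limit, defined by `e(ρ) = lim_{N,L→∞, ρ = N/L³} E(N,L)/L³`."
* "**Theorem 1.1.** Let `V ∈ L³(ℝ³)` be non-negative, radially symmetric, with `supp(V) ⊂ B_R(0)`
  and scattering length `𝔞 ≤ R`. Then, the specific ground state energy `e(ρ)` of the Hamilton
  operator `H_L` defined in (1.1) satisfies
  `e(ρ) ≤ 4πρ²𝔞 [1 + (128/(15√π)) (ρ𝔞³)^{1/2}] + C ρ^{5/2+1/10}` for some `C > 0` and for `ρ`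
  small enough. *Remark:* since Dirichlet boundary conditions lead to the largest energy, the
  upper bound (1.3) holds in fact for arbitrary boundary conditions."
* Lemma 6.4 (proof of the localisation Prop. 1.2): "we use the existence of the thermodynamic
  limit of the specific energy and its convexity (see [Ruelle])".

Earlier/other second-order upper bounds (quoted, not vendored): Yau–Yin 2009 (smooth `V`,
Thm. 1.1: `e(ρ) ≤ 4π𝔞ρ²[1 + (128/(15√π))(ρ𝔞³)^{1/2}] + O(ρ²𝔞(ρ𝔞³)^{1/2+γ})`), Erdős–Schlein–Yau
2008 (order only), Basti–Cenatiempo–Giuliani–Olgiati–Pasqualetti–Schlein 2024 (hard spheres).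

## Lean rendering

* Units `ħ = 2m = 1` and the Dirichlet ground-state energy `E(N,L)` are the tree's
  (`Literature.MathematicalPhysics.QuantumManyBody.BoseGas.groundStateEnergy v N L`, infimum of the
  quadratic form over `C¹` Bose-symmetric functions vanishing off the open box `(0,L)³` — a form
  core, so the infimum is the bottom of the Dirichlet spectrum for `V ∈ L³ ⊇ L^{3/2}_{loc}`; the
  box `[-L/2, L/2]³` of the source is a translate). The pair potential is a radial profile
  `v : ℝ → ℝ≥0∞`, `V(x) = v(|x|)` (radial symmetry and non-negativity are automatic);
  "`V ∈ L³`" is `∫ v(|x|)³ dx < ∞`, "`supp V ⊂ B_R(0)`" is `v(r) = 0` for `r > R`, and `𝔞` is the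
  tree's variational `scatteringLength v` (LSSY App. C), read in `ℝ` (`toReal`; finite here).
* **`e(ρ)`.** The joint limit "`N, L → ∞`, `ρ = N/L³`" runs over the boxes with `ρL³ = N ∈ ℕ`,
  i.e. over the sequence `L_N = (N/ρ)^{1/3} = sideLength ρ N`. The source DEFINES `e(ρ)` as this
  limit and uses its existence and convexity (Ruelle 1969 / Robinson 1971; Lemma 6.4); a limit,
  when it exists, is the `limsup` of the sequence, so the fact below states the printed inequality
  for `limsup_{N→∞} E(N, L_N)/L_N³` — the printed theorem for the printed object, with no
  existence claim added and nothing weakened (in particular it is NOT the weaker `liminf` form).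
* Constants: "for some `C > 0` and for `ρ` small enough" is `∃ C ρ₁ > 0, ∀ ρ ∈ (0, ρ₁)`, chosen
  after `v` and `R` (they depend on `V`).
* The COROLLARY `….dirichlet_eventually` (proved here from the fact) is the fixed-density,
  finite-`N` Dirichlet form consumed by the route: for bounded finite-range `v` with `𝔞 > 0` there
  are `C, ρ₁ > 0` with `E(N, L_N) ≤ 4πρ𝔞(1 + C√(ρ𝔞³))N` for `0 < ρ < ρ₁` and all large `N`
  (take `C = 128/(15√π) + 1`: the printed error `Cρ^{2.6}` is `< 4π𝔞^{5/2}ρ^{5/2}` for small `ρ`,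
  so `limsup < ` the target and the sequence is eventually below it).

## References

* [BastiCenatiempoSchlein2021] G. Basti, S. Cenatiempo, B. Schlein, A new second-order upper bound
  for the ground state energy of dilute Bose gases, Forum Math. Sigma 9 (2021) e74, Thm. 1.1,
  Prop. 1.2, Lemma 6.4.
* [YauYin2009] H.-T. Yau, J. Yin, The second order upper bound for the ground energy of a Bose
  gas, J. Stat. Phys. 136 (2009) 453–503, Thm. 1.1.
* [ErdosSchleinYau2008] L. Erdős, B. Schlein, H.-T. Yau, Phys. Rev. A 78 (2008) 053627, Thm. 1.
* [Ruelle1969] D. Ruelle, Statistical Mechanics: Rigorous Results (1969), §3.5 (thermodynamic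
  limit of the ground-state energy density, convexity).
* [Robinson1971] D. W. Robinson, The Thermodynamic Pressure in Quantum Statistical Mechanics,
  LNP 9 (1971) (boundary-condition independence).
* [LSSY2005] Lieb–Seiringer–Solovej–Yngvason, The Mathematics of the Bose Gas and its
  Condensation (2005), Ch. 2, App. C.
-/

noncomputable section

open MeasureTheory Filter Metric
open scoped ENNReal NNReal Topology

namespace Literature.MathematicalPhysics.QuantumManyBody.BoseGas

/-- The Lee–Huang–Yang constant `128/(15√π)` of the second-order term
`e(ρ) = 4π𝔞ρ²[1 + (128/(15√π))(ρ𝔞³)^{1/2} + o((ρ𝔞³)^{1/2})]`.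
[cite: BastiCenatiempoSchlein2021, (1.2)] -/
def lhyConstant : ℝ := 128 / (15 * Real.sqrt Real.pi)

/-- `128/(15√π) > 0`. [cite: BastiCenatiempoSchlein2021, (1.2)] -/
theorem lhyConstant_pos : 0 < lhyConstant := by
  unfold lhyConstant; positivity

/-- **Basti–Cenatiempo–Schlein (2021), Theorem 1.1 — second-order upper bound on the specific
ground-state energy of the dilute Bose gas.** For `V(x) = v(|x|)` with `V ∈ L³(ℝ³)`, `V ≥ 0`,
`supp V ⊂ B_R(0)` and scattering length `𝔞 ≤ R`, the specific ground-state energy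
`e(ρ) = lim_{N,L→∞, ρ=N/L³} E(N,L)/L³` of `H_L = -∑Δᵢ + ∑_{i<j}V(xᵢ-xⱼ)` with DIRICHLET boundary
conditions (units `ħ = 2m = 1`) satisfies
`e(ρ) ≤ 4πρ²𝔞[1 + (128/(15√π))(ρ𝔞³)^{1/2}] + Cρ^{5/2+1/10}` for some `C > 0` and all `ρ` small
enough. Rendering (module docstring): `E(N,L)` is `groundStateEnergy v N L`; the limit defining
`e(ρ)` runs over `L_N = sideLength ρ N = (N/ρ)^{1/3}` and is entered as the `limsup` of
`E(N, L_N)/L_N³` (equal to the printed limit, whose existence — Ruelle/Robinson — the source uses);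
`𝔞 = (scatteringLength v).toReal`. Statement only (proof: a Bogoliubov-type trial state on the
Fock space of a periodic box of side `ρ^{-γ}`, `γ > 1`, Prop. 2.1, and the localisation
Prop. 1.2 back to Dirichlet boxes and fixed `N`). [cite: BastiCenatiempoSchlein2021, Thm. 1.1]
[cite: YauYin2009, Thm. 1.1] -/
def BastiCenatiempoSchlein2021_upperBound : Prop :=
  ∀ (v : ℝ → ℝ≥0∞) (R : ℝ), Measurable v → (∀ r, R < r → v r = 0) →
    (∫⁻ x : Space, v ‖x‖ ^ 3) ≠ ⊤ → scatteringLength v ≤ ENNReal.ofReal R →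
  ∃ C ρ₁ : ℝ, 0 < C ∧ 0 < ρ₁ ∧
    ∀ ρ : ℝ, 0 < ρ → ρ < ρ₁ →
      let a := (scatteringLength v).toReal
      limsup (fun N : ℕ ↦ groundStateEnergy v N (sideLength ρ N) / ENNReal.ofReal (sideLength ρ N ^ 3)) atTop ≤
        ENNReal.ofReal (4 * Real.pi * ρ ^ 2 * a * (1 + lhyConstant * Real.sqrt (ρ * a ^ 3)) +
          C * ρ ^ ((5 : ℝ) / 2 + 1 / 10))

/-! ### The fixed-density, finite-`N` Dirichlet corollary (the form `LhyOrderUpperBound` of the route) -/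

/-- A bounded profile vanishing beyond `R₀` gives `V = v(|·|) ∈ L³(ℝ³)`. [folklore] -/
theorem lintegral_pow_three_ne_top {v : ℝ → ℝ≥0∞} {R₀ Cv : ℝ} (hR₀ : ∀ r, R₀ < r → v r = 0)
    (hCv : ∀ r, v r ≤ ENNReal.ofReal Cv) : (∫⁻ x : Space, v ‖x‖ ^ 3) ≠ ⊤ := by
  have hle : ∀ x : Space, v ‖x‖ ^ 3 ≤ (closedBall (0 : Space) R₀).indicator (fun _ ↦ ENNReal.ofReal Cv ^ 3) x := by
    intro x
    by_cases hx : x ∈ closedBall (0 : Space) R₀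
    · rw [Set.indicator_of_mem hx]
      exact pow_le_pow_left' (hCv _) 3
    · rw [Set.indicator_of_notMem hx]
      rw [mem_closedBall, dist_zero_right, not_le] at hx
      simp [hR₀ _ hx]
  refine ne_top_of_le_ne_top ?_ (lintegral_mono hle)
  rw [lintegral_indicator_const measurableSet_closedBall]
  exact ENNReal.mul_ne_top (ENNReal.pow_ne_top ENNReal.ofReal_ne_top) measure_closedBall_lt_top.ne

/-- The elementary inequality behind the corollary: for `0 < ρ`, `0 < a` with
`C₀ ρ^{1/10} < 4π a^{5/2}`,
`4πρ²a(1 + c√(ρa³)) + C₀ρ^{5/2+1/10} < 4πρ²a(1 + (c+1)√(ρa³))`. [folklore] -/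
theorem lhy_error_absorb {ρ a c C₀ : ℝ} (hρ : 0 < ρ) (ha : 0 < a)
    (hkey : C₀ * ρ ^ ((1 : ℝ) / 10) < 4 * Real.pi * a ^ ((5 : ℝ) / 2)) :
    4 * Real.pi * ρ ^ 2 * a * (1 + c * Real.sqrt (ρ * a ^ 3)) + C₀ * ρ ^ ((5 : ℝ) / 2 + 1 / 10) <
      4 * Real.pi * ρ ^ 2 * a * (1 + (c + 1) * Real.sqrt (ρ * a ^ 3)) := by
  have e1 : Real.sqrt (ρ * a ^ 3) = ρ ^ ((1 : ℝ) / 2) * a ^ ((3 : ℝ) / 2) := by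
    rw [Real.sqrt_eq_rpow, Real.mul_rpow hρ.le (by positivity), ← Real.rpow_natCast a 3,
      ← Real.rpow_mul ha.le]
    norm_num
  have e2 : ρ ^ ((5 : ℝ) / 2 + 1 / 10) = ρ ^ 2 * ρ ^ ((1 : ℝ) / 2) * ρ ^ ((1 : ℝ) / 10) := by
    rw [show (5 : ℝ) / 2 + 1 / 10 = 2 + 1 / 2 + 1 / 10 by norm_num, Real.rpow_add hρ, Real.rpow_add hρ,
      Real.rpow_two]
  have e3 : a * a ^ ((3 : ℝ) / 2) = a ^ ((5 : ℝ) / 2) := by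
    rw [show (5 : ℝ) / 2 = 1 + 3 / 2 by norm_num, Real.rpow_add ha, Real.rpow_one]
  rw [e1, e2, ← sub_pos]
  have hpos : 0 < ρ ^ 2 * ρ ^ ((1 : ℝ) / 2) := by positivity
  have hfac : 4 * Real.pi * ρ ^ 2 * a * (1 + (c + 1) * (ρ ^ ((1 : ℝ) / 2) * a ^ ((3 : ℝ) / 2))) -
      (4 * Real.pi * ρ ^ 2 * a * (1 + c * (ρ ^ ((1 : ℝ) / 2) * a ^ ((3 : ℝ) / 2))) +
        C₀ * (ρ ^ 2 * ρ ^ ((1 : ℝ) / 2) * ρ ^ ((1 : ℝ) / 10))) =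
      ρ ^ 2 * ρ ^ ((1 : ℝ) / 2) * (4 * Real.pi * (a * a ^ ((3 : ℝ) / 2)) - C₀ * ρ ^ ((1 : ℝ) / 10)) := by
    ring
  rw [hfac, e3]
  exact mul_pos hpos (sub_pos.2 hkey)

/-- **Corollary (fixed density, finite `N`, Dirichlet boxes) — the shape of `LhyOrderUpperBound`.**
From Theorem 1.1: for every bounded, measurable, finite-range profile `v` with `∫ v(|x|)dx < ∞`
and `𝔞 > 0` there are `C` and `ρ₁ > 0` such that for all `0 < ρ < ρ₁`, for all sufficiently large
`N`, the Dirichlet ground-state energy of `N` bosons in the box of side `(N/ρ)^{1/3}` is at most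
`4πρ𝔞(1 + C√(ρ𝔞³))N` — an order-`√(ρ𝔞³)` (Lee–Huang–Yang-order) upper bound. Proof: with
`C = 128/(15√π) + 1` the printed bound is `< 4πρ²𝔞(1 + C√(ρ𝔞³))` once
`C₀ρ^{1/10} < 4π𝔞^{5/2}` (`lhy_error_absorb`), so the `limsup` of `E(N,L_N)/L_N³` is below the
target and the sequence is eventually below it; `L_N³ = N/ρ`.
[cite: BastiCenatiempoSchlein2021, Thm. 1.1 and the Remark following it] -/
theorem BastiCenatiempoSchlein2021_upperBound.dirichlet_eventually
    (h : BastiCenatiempoSchlein2021_upperBound) :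
    ∀ v : ℝ → ℝ≥0∞, IsRepulsiveFiniteRange v → (∫⁻ x : Space, v ‖x‖) ≠ ⊤ →
      (∃ C : ℝ, ∀ r, v r ≤ ENNReal.ofReal C) → 0 < scatteringLength v →
      ∃ C ρ₁ : ℝ, 0 < ρ₁ ∧ ∀ ρ : ℝ, 0 < ρ → ρ < ρ₁ →
        ∀ᶠ N : ℕ in atTop, groundStateEnergy v N (sideLength ρ N) ≤
          ENNReal.ofReal (4 * Real.pi * ρ * (scatteringLength v).toReal *
            (1 + C * Real.sqrt (ρ * (scatteringLength v).toReal ^ 3)) * N) := by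
  intro v hv hint hbdd ha
  obtain ⟨hmeas, R₀, hR₀⟩ := hv
  obtain ⟨Cv, hCv⟩ := hbdd
  -- the scattering length is finite and positive
  have hmeas' : Measurable fun x : Space ↦ v ‖x‖ := hmeas.comp measurable_norm
  have hfin : scatteringLength v ≠ ⊤ := by
    refine scatteringLength_ne_top ?_
    rw [lintegral_const_mul _ hmeas']
    exact ENNReal.mul_ne_top (by simp) hint
  set a := (scatteringLength v).toReal with ha_def
  have ha_pos : 0 < a := ENNReal.toReal_pos ha.ne' hfin
  -- apply Theorem 1.1 with `R = max R₀ a`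
  have hL3fin : (∫⁻ x : Space, v ‖x‖ ^ 3) ≠ ⊤ := lintegral_pow_three_ne_top hR₀ hCv
  have hRa : scatteringLength v ≤ ENNReal.ofReal (max R₀ a) := by
    rw [← ENNReal.ofReal_toReal hfin]
    exact ENNReal.ofReal_le_ofReal (le_max_right _ _)
  obtain ⟨C₀, ρ₁', hC₀, hρ₁', hmain⟩ :=
    h v (max R₀ a) hmeas (fun r hr ↦ hR₀ r (lt_of_le_of_lt (le_max_left _ _) hr)) hL3fin hRa
  -- the density threshold: `C₀ ρ^{1/10} < 4π a^{5/2}` for `ρ < K^10`, `K = 4π a^{5/2}/C₀`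
  set K : ℝ := 4 * Real.pi * a ^ ((5 : ℝ) / 2) / C₀ with hK_def
  have hK : 0 < K := by positivity
  refine ⟨lhyConstant + 1, min ρ₁' (K ^ 10), lt_min hρ₁' (by positivity), fun ρ hρ hρ₁ ↦ ?_⟩
  have hρ1 : ρ < ρ₁' := lt_of_lt_of_le hρ₁ (min_le_left _ _)
  have hρK : ρ < K ^ 10 := lt_of_lt_of_le hρ₁ (min_le_right _ _)
  have hkey : C₀ * ρ ^ ((1 : ℝ) / 10) < 4 * Real.pi * a ^ ((5 : ℝ) / 2) := by
    have h1 : ρ ^ ((1 : ℝ) / 10) < K := by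
      calc ρ ^ ((1 : ℝ) / 10) < (K ^ 10) ^ ((1 : ℝ) / 10) :=
            Real.rpow_lt_rpow hρ.le hρK (by norm_num)
        _ = K := by
            rw [show ((1 : ℝ) / 10) = ((10 : ℕ) : ℝ)⁻¹ by norm_num]
            exact Real.pow_rpow_inv_natCast hK.le (by norm_num)
    calc C₀ * ρ ^ ((1 : ℝ) / 10) < C₀ * K := mul_lt_mul_of_pos_left h1 hC₀
      _ = 4 * Real.pi * a ^ ((5 : ℝ) / 2) := by rw [hK_def]; field_simp
  -- `limsup <` the target constant
  set B' : ℝ := 4 * Real.pi * ρ ^ 2 * a * (1 + (lhyConstant + 1) * Real.sqrt (ρ * a ^ 3)) with hB'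
  have hB'pos : 0 < B' := by
    have := lhyConstant_pos
    rw [hB']; positivity
  have hlt : limsup (fun N : ℕ ↦ groundStateEnergy v N (sideLength ρ N) /
      ENNReal.ofReal (sideLength ρ N ^ 3)) atTop < ENNReal.ofReal B' := by
    refine lt_of_le_of_lt (hmain ρ hρ hρ1) ?_
    rw [ENNReal.ofReal_lt_ofReal_iff hB'pos, hB']
    exact lhy_error_absorb hρ ha_pos hkey
  have hev := Filter.eventually_lt_of_limsup_lt hlt
  filter_upwards [hev, eventually_ge_atTop 1] with N hN hN1
  -- clear the denominator `L_N³ = N/ρ`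
  have hNpos : 0 < N := hN1
  have hL : 0 < sideLength ρ N := Real.rpow_pos_of_pos (div_pos (Nat.cast_pos.2 hNpos) hρ) _
  have hL3 : sideLength ρ N ^ 3 = N / ρ := by
    rw [eq_div_iff hρ.ne']
    have hd := div_sideLength_pow_three hρ hNpos
    rw [div_eq_iff (pow_pos hL 3).ne'] at hd
    linarith [hd]
  have h0 : ENNReal.ofReal (sideLength ρ N ^ 3) ≠ 0 := (ENNReal.ofReal_pos.2 (pow_pos hL 3)).ne'
  rw [ENNReal.div_lt_iff (Or.inl h0) (Or.inl ENNReal.ofReal_ne_top), ← ENNReal.ofReal_mul hB'pos.le] at hN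
  refine hN.le.trans (le_of_eq ?_)
  congr 1
  rw [hL3, hB']
  field_simp

end Literature.MathematicalPhysics.QuantumManyBody.BoseGas

end
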